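import Literature.Probability.RandomPlanarGeometry.SLE
import Literature.Probability.RandomPlanarGeometry.ConformalRemovability
import HarnessLib

/-!
# Conformal removability of the SLE₄ trace (Kavvadias–Miller–Schoug 2022, Thm 1.1)

Named fact (statement only) from K. Kavvadias, J. Miller, L. Schoug, *Conformal removability of
SLE₄*, arXiv:2209.10532 (v1, 21 Sep 2022; held) [`KavvadiasMillerSchoug2022`].

* **Theorem 1.1** (p. 3, read verbatim): *"Suppose that `η` is an SLE₄ in `ℍ` from `0` to `∞`.
  Suppose that `f : ℍ → ℍ` is a homeomorphism which is conformal on `ℍ ∖ η`. Then `f` is a.s.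
  conformal on `η`. In particular, the range of `η` is a.s. conformally removable."* Remark after it
  (p. 3): "Theorem 1.1 applies if `η` is an SLE₄ in an arbitrary simply connected domain `D` since
  one can always conformally map `D` to `ℍ`."
* **What the proof establishes** (p. 61): *"Proof of Theorem 1.1. We will show that `η` satisfies
  the conditions of Theorem 8.1 a.s., which completes the proof."* and **Theorem 8.1** (p. 62):
  *"Suppose that `D ⊆ ℂ` is open and `X ⊆ D` is closed in `D` and satisfies the above assumptions.
  If `f : D → ℂ` is a homeomorphism onto its image and conformal on `D ∖ X` then `f` is conformal
  on `D`."* With `D = ℍ` and `X = η[0, ∞)` the conclusion of Theorem 8.1 is VERBATIM the tree's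
  notion `IsConformallyRemovableIn ℍ (range η)` (`ConformalRemovability.lean`, Jones–Smirnov Def. 1
  with the maps spelled out: every `F : ℂ → ℂ` continuous and injective on `ℍ` — for the open set
  `ℍ`, a homeomorphism onto its image by invariance of domain,
  `Literature/Topology/Euclidean/InvarianceOfDomain.lean` — and holomorphic (= conformal, being
  injective) on `ℍ ∖ range η` is holomorphic on `ℍ`). This is the form stated here, as the fact
  `KavvadiasMillerSchoug2022_thm11`; the printed consequences (self-homeomorphisms of `ℍ`;
  whole-plane removability by the Riemann mapping theorem) follow from it (`IsConformallyRemovableIn.self_maps`).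

Conventions. "SLE₄ in `ℍ` from `0` to `∞`" is the chordal Loewner chain driven by `√4·B` on the
canonical space (`sleDriving 4`, `(ℝ≥0 → ℝ, preWienerMeasure)`, chordal Loewner equation
`∂ₜ gₜ = 2/(gₜ - Wₜ)`, `LoewnerChain.lean`), `η = sleTrace 4 ω` its trace (`SLE.lean`; the Loewner
trace when the chain is generated by a curve — a.s. the case, Rohde–Schramm Thm 5.1, proved in the
tree as `hasSLETrace_of_ne_eight_holds` — and a documented junk constant otherwise, immaterial for
an a.s. statement); "a.s." is `∀ᵐ ω ∂preWienerMeasure`; `range η = η[0, ∞)` includes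
`η 0 = 0 ∉ ℍ`, immaterial since only `range η ∩ ℍ` matters (`IsConformallyRemovableIn.iff_inter`).
The consumer is crux `RemovableLimit` (stmt-CriticalPhenomena-4503) of route
`CriticalPhenomena/SAWWeldingIdentification`, where it pays the corner `κ = 4` of "simple-phase SLE
laws are carried by conformally removable curves" (Rohde–Schramm Thm 5.2 gives Hölder domains only
for `κ ≠ 4`; KMS p. 3: SLE₄ is not the boundary of a Hölder domain and fails the Jones–Smirnov
condition). Not here: Theorem 8.1 itself (the general sufficient condition), Theorem 1.2 ff.
(welding uniqueness for critical LQG), the transfer to other domains (done Summits-side along the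
chordal uniformiser by `IsConformallyRemovableIn.image_conformalEquiv`).
-/

noncomputable section

namespace Literature.Probability.RandomPlanarGeometry

open _root_.MeasureTheory Set
open UpperHalfPlane (upperHalfPlaneSet)
open scoped NNReal

/-- **Kavvadias–Miller–Schoug 2022, Theorem 1.1 (conformal removability of SLE₄), in the form its
proof establishes through their Theorem 8.1**: for the trace `η = sleTrace 4 ω` of chordal SLE₄ in
`ℍ` from `0` to `∞`, almost surely the range of `η` is conformally removable inside `ℍ` — every map
continuous and injective on `ℍ` (a homeomorphism onto its image) and holomorphic on `ℍ ∖ η[0, ∞)`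
is holomorphic on `ℍ` (`IsConformallyRemovableIn ℍ (range η)`). In particular (as printed) every
homeomorphism `ℍ → ℍ` conformal off `η` is conformal, and the range of `η` is conformally removable.
Users take `(h : KavvadiasMillerSchoug2022_thm11)`.
[cite: KavvadiasMillerSchoug2022, Thm 1.1 (p. 3), proof p. 61 via Thm 8.1 (p. 62)] -/
def KavvadiasMillerSchoug2022_thm11 : Prop :=
  ∀ᵐ ω ∂Process.preWienerMeasure,
    IsConformallyRemovableIn upperHalfPlaneSet (range (sleTrace 4 ω))

end Literature.Probability.RandomPlanarGeometry

end
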